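import Summits.FinalStateConjecture.FinalStateConjecture.Theorems.PhotonSphereChannelsWindowedShellChannelsStubFarHalfShareCompact

/-!
# Crux `WindowedShellChannels` (stmt-FinalStateConjecture-14085), line `Sketch` — stub `stub_farHalfShare`,
# part 2: the two-sided far estimate at apex `0` for compactly supported far data, one mode

`stub_farHalfShare_compact`: for one mode `(s, ℓ)`, `s ≤ 2`, `s ≤ ℓ`, of the unit-mass Regge–Wheeler
equation along the centred tortoise line there is `R_c` such that every global `C²` solution with
Cauchy data supported in a far interval `(R₀, B)`, `R_c ≤ R₀ ≤ B`, satisfies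

  `(1/16)·E ≤ liminf_{t→+∞} ∫⁻_{x>|t|} e[ψ](t) + liminf_{t→−∞} ∫⁻_{x>|t|} e[ψ](t)`.

Assembly of part 1 (`FarHalfShareModel.stub_farHalfShare_transfer`, the far-potential bounds) with the model waves of
`Literature.Analysis.PDE.InverseSquareConeModelWave` (`ℓ ≥ 1`: cut regular exact inverse-square wave;
`ℓ = 0`: d'Alembert), after checking that the true energy of far data is at most twice the model
energy (`energy_le_two_model_pos`: `V ≤ (3/2)ℓ(ℓ+1)/x²` far out; `energy_le_two_model_zero`:
`∫Vh² ≤ (108/R₀)∫h′²` from `V ≤ 54/x³` and `h(x)² ≤ 2(x − R₀)∫h′²`).  No definitions.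
[folklore in method; new]
-/

noncomputable section

set_option linter.dupNamespace false

namespace Summit.FinalStateConjecture.FinalStateConjecture.Theorems.WindowedShellChannelsSketch

open Literature.Geometry.Lorentzian Literature.Geometry.Lorentzian.ReggeWheeler Filter Set MeasureTheory
open Literature.Analysis.PDE Literature.Analysis.ODE Literature.Analysis.Calculus Real intervalIntegral
open scoped ENNReal Topology

namespace FarHalfShareModel

variable {ψ : ℝ → ℝ → ℝ}

/-- The total energy of far data supported in `(R₀, B)` as a real interval integral. [folklore] -/
theorem toReal_totalEnergy_eq {s ℓ : ℕ} (hsℓ : s ≤ ℓ)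
    (hψ : IsRWSolution 1 s ℓ (tortoiseRadius one_pos 0) ψ) {R₀ B : ℝ} (hR₀B : R₀ ≤ B)
    (hsupp : CauchyDataSupportedOn ψ (Ioo R₀ B)) :
    (totalEnergy (linePotential 1 s ℓ (tortoiseRadius one_pos 0)) ψ 0).toReal
      = ∫ x in R₀..B, (deriv (fun τ => ψ τ x) 0 ^ 2 + deriv (ψ 0) x ^ 2
          + linePotential 1 s ℓ (tortoiseRadius one_pos 0) x * ψ 0 x ^ 2) := by
  have hr := isTortoiseRadius_tortoiseRadius one_pos (0 : ℝ)
  rw [RW.totalEnergy_eq_rw hr hsℓ hψ hR₀B hsupp 0, ENNReal.toReal_ofReal]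
  · rfl
  · exact integral_nonneg hR₀B fun x _ => energyDensity_nonneg ψ 0 (RW.linePotential_pos hr hsℓ x).le

/-- **Energy comparison, `ℓ ≥ 1`**: far out the true energy is at most twice the model energy
`∫ h′² + ℓ(ℓ+1)ι²h² + g²`. [folklore] -/
theorem energy_le_two_model_pos {s ℓ : ℕ} (hs : s ≤ 2) (hsℓ : s ≤ ℓ) (hℓ : 1 ≤ ℓ) {ι : ℝ → ℝ}
    (hι : Continuous ι) (hιeq : ∀ x : ℝ, 1 / 2 ≤ x → ι x = x⁻¹)
    (hψ : IsRWSolution 1 s ℓ (tortoiseRadius one_pos 0) ψ) {R₀ B : ℝ}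
    (hR₀ : max 9 (4 * (200 * ((ℓ : ℝ) + 1) ^ 2) ^ 2) ≤ R₀) (hR₀B : R₀ ≤ B)
    (hsupp : CauchyDataSupportedOn ψ (Ioo R₀ B)) :
    (totalEnergy (linePotential 1 s ℓ (tortoiseRadius one_pos 0)) ψ 0).toReal
      ≤ 2 * ∫ x in R₀..B, (deriv (ψ 0) x ^ 2 + (ℓ : ℝ) * (ℓ + 1) * ι x ^ 2 * (ψ 0) x ^ 2
          + deriv (fun τ => ψ τ x) 0 ^ 2) := by
  have hr := isTortoiseRadius_tortoiseRadius one_pos (0 : ℝ)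
  rw [toReal_totalEnergy_eq hsℓ hψ hR₀B hsupp, ← intervalIntegral.integral_const_mul]
  have hC := hψ.1
  have hV := (RW.differentiable_linePotential hr s ℓ).continuous
  have hh : Continuous (deriv (ψ 0)) :=
    (hC.comp (contDiff_const.prodMk contDiff_id)).continuous_deriv (by norm_num)
  have hg : Continuous (fun x => deriv (fun τ => ψ τ x) 0) := (contDiff_one_tslice_deriv hC 0).continuous
  have h0 : Continuous (ψ 0) := hC.continuous.comp (continuous_const.prodMk continuous_id)
  have hιc : Continuous (fun x => (ℓ : ℝ) * (ℓ + 1) * ι x ^ 2 * (ψ 0) x ^ 2) :=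
    (continuous_const.mul (hι.pow 2)).mul (h0.pow 2)
  refine intervalIntegral.integral_mono_on hR₀B ?_ ?_ fun x hx => ?_
  · exact ((hg.pow 2).add (hh.pow 2) |>.add (hV.mul (h0.pow 2))).intervalIntegrable _ _
  · exact ((((hh.pow 2).add hιc).add (hg.pow 2)).const_mul 2).intervalIntegrable _ _
  · have hx9 : max 9 (4 * (200 * ((ℓ : ℝ) + 1) ^ 2) ^ 2) ≤ x := hR₀.trans hx.1
    obtain ⟨-, hup, -⟩ := far_bounds_pos hs hℓ hx9
    have hx9' : 9 ≤ x := (le_max_left _ _).trans hx9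
    have hxpos : 0 < x := by linarith
    have hι2 : ι x ^ 2 = (x ^ 2)⁻¹ := by rw [hιeq x (by linarith), inv_pow]
    rw [hι2]
    have hV0 := (RW.linePotential_pos hr hsℓ x).le
    have hP : 0 ≤ (ℓ : ℝ) * (ℓ + 1) * (x ^ 2)⁻¹ * ψ 0 x ^ 2 := by positivity
    nlinarith [sq_nonneg (deriv (ψ 0) x), sq_nonneg (deriv (fun τ => ψ τ x) 0),
      mul_le_mul_of_nonneg_right hup (sq_nonneg (ψ 0 x))]

/-- **Energy comparison, `ℓ = 0`** (`s = 0`): for data supported in `(R₀, B)` with `R₀ ≥ 108`,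
`∫Vh² ≤ ∫h′²`, so the true energy is at most twice the free energy `∫ h′² + g²`. [folklore] -/
theorem energy_le_two_model_zero (hψ : IsRWSolution 1 0 0 (tortoiseRadius one_pos 0) ψ) {R₀ B : ℝ}
    (hR₀ : 108 ≤ R₀) (hR₀B : R₀ ≤ B) (hsupp : CauchyDataSupportedOn ψ (Ioo R₀ B)) :
    (totalEnergy (linePotential 1 0 0 (tortoiseRadius one_pos 0)) ψ 0).toReal
      ≤ 2 * ∫ x in R₀..B, (deriv (ψ 0) x ^ 2 + deriv (fun τ => ψ τ x) 0 ^ 2) := by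
  have hr := isTortoiseRadius_tortoiseRadius one_pos (0 : ℝ)
  rw [toReal_totalEnergy_eq le_rfl hψ hR₀B hsupp]
  have hC := hψ.1
  set V := linePotential 1 0 0 (tortoiseRadius one_pos 0) with hVdef
  have hVc : Continuous V := (RW.differentiable_linePotential hr 0 0).continuous
  have hV0 : ∀ x, 0 ≤ V x := fun x => (RW.linePotential_pos hr le_rfl x).le
  set h : ℝ → ℝ := ψ 0 with hh
  have hhC : ContDiff ℝ 2 h := hC.comp (contDiff_const.prodMk contDiff_id)
  have hh' : Continuous (deriv h) := hhC.continuous_deriv (by norm_num)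
  have hg : Continuous (fun x => deriv (fun τ => ψ τ x) 0) := (contDiff_one_tslice_deriv hC 0).continuous
  have h0c : Continuous h := hhC.continuous
  have hR₀0 : 0 < R₀ := by linarith
  -- `I = ∫ h'²`
  set I : ℝ := ∫ x in R₀..B, deriv h x ^ 2 with hI
  have hI0 : 0 ≤ I := integral_nonneg hR₀B fun x _ => sq_nonneg _
  have hhR₀ : h R₀ = 0 := (hsupp R₀ (fun hx => lt_irrefl _ hx.1)).1
  -- pointwise: `V h² ≤ 108 I (x²)⁻¹` on `[R₀, B]`
  have hpt : ∀ x ∈ Icc R₀ B, V x * h x ^ 2 ≤ 108 * I * (x ^ 2)⁻¹ := by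
    intro x hx
    have hx0 : 0 < x := by linarith [hx.1]
    have h1 := sq_le_of_sq_deriv (hhC.of_le (by norm_num)) hx.1
    rw [hhR₀] at h1
    have h2 : (∫ y in R₀..x, deriv h y ^ 2) ≤ I :=
      integral_mono_interval le_rfl hx.1 hx.2 (Eventually.of_forall fun y => sq_nonneg _)
        ((hh'.pow 2).intervalIntegrable _ _)
    have h3 : h x ^ 2 ≤ 2 * x * I := by
      have : 0 ≤ x - R₀ := by linarith [hx.1]
      have hJ0 : 0 ≤ ∫ y in R₀..x, deriv h y ^ 2 :=
        intervalIntegral.integral_nonneg hx.1 fun y _ => sq_nonneg _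
      nlinarith
    have hV := far_bound_zero hx0
    have hrp : x ^ (-(3 : ℝ)) = (x ^ 3)⁻¹ := by
      rw [rpow_neg hx0.le, show (3 : ℝ) = ((3 : ℕ) : ℝ) by norm_num, rpow_natCast]
    rw [hrp] at hV
    calc V x * h x ^ 2 ≤ (54 * (x ^ 3)⁻¹) * (2 * x * I) :=
          mul_le_mul hV h3 (sq_nonneg _) (by positivity)
      _ = 108 * I * (x ^ 2)⁻¹ := by field_simp; ring
  -- `∫_{R₀}^B (x²)⁻¹ ≤ 1/R₀`
  have hinv : (∫ x in R₀..B, (x ^ 2)⁻¹) ≤ R₀⁻¹ := by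
    have hderiv : ∀ x ∈ uIcc R₀ B, HasDerivAt (fun y : ℝ => -y⁻¹) ((x ^ 2)⁻¹) x := by
      intro x hx
      rw [uIcc_of_le hR₀B] at hx
      have hx0 : x ≠ 0 := (show (0 : ℝ) < x by linarith [hx.1]).ne'
      simpa using (hasDerivAt_inv hx0).fun_neg
    have hcont : ContinuousOn (fun x : ℝ => (x ^ 2)⁻¹) (uIcc R₀ B) := by
      refine ContinuousOn.inv₀ (continuousOn_pow 2) fun x hx => ?_
      rw [uIcc_of_le hR₀B] at hx
      exact pow_ne_zero 2 (show (0 : ℝ) < x by linarith [hx.1]).ne'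
    rw [integral_eq_sub_of_hasDerivAt hderiv (hcont.intervalIntegrable)]
    have hB0 : 0 < B := by linarith
    have : 0 ≤ B⁻¹ := by positivity
    linarith
  have hVint : (∫ x in R₀..B, V x * h x ^ 2) ≤ I := by
    have hc2 : ContinuousOn (fun x : ℝ => 108 * I * (x ^ 2)⁻¹) (uIcc R₀ B) := by
      refine continuousOn_const.mul (ContinuousOn.inv₀ (continuousOn_pow 2) fun x hx => ?_)
      rw [uIcc_of_le hR₀B] at hx
      exact pow_ne_zero 2 (show (0 : ℝ) < x by linarith [hx.1]).ne'
    calc (∫ x in R₀..B, V x * h x ^ 2) ≤ ∫ x in R₀..B, 108 * I * (x ^ 2)⁻¹ :=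
          intervalIntegral.integral_mono_on hR₀B ((hVc.mul (h0c.pow 2)).intervalIntegrable _ _)
            hc2.intervalIntegrable hpt
      _ = 108 * I * ∫ x in R₀..B, (x ^ 2)⁻¹ := intervalIntegral.integral_const_mul _ _
      _ ≤ 108 * I * R₀⁻¹ := mul_le_mul_of_nonneg_left hinv (by positivity)
      _ ≤ I := by
          rw [mul_assoc]
          have : 108 * R₀⁻¹ ≤ 1 := by rw [← div_eq_mul_inv, div_le_one hR₀0]; exact hR₀
          nlinarith
  -- assemble
  have hBi : IntervalIntegrable (fun x => deriv (ψ 0) x ^ 2 + deriv (fun τ => ψ τ x) 0 ^ 2)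
      volume R₀ B := ((hh'.pow 2).add (hg.pow 2)).intervalIntegrable _ _
  have hCi : IntervalIntegrable (fun x => V x * h x ^ 2) volume R₀ B :=
    (hVc.mul (h0c.pow 2)).intervalIntegrable _ _
  have hsplit : (∫ x in R₀..B, (deriv (fun τ => ψ τ x) 0 ^ 2 + deriv (ψ 0) x ^ 2 + V x * ψ 0 x ^ 2))
      = (∫ x in R₀..B, (deriv (ψ 0) x ^ 2 + deriv (fun τ => ψ τ x) 0 ^ 2))
        + ∫ x in R₀..B, V x * h x ^ 2 := by
    rw [← intervalIntegral.integral_add hBi hCi]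
    exact integral_congr fun x _ => by simp only [hh]; ring
  have hIle : I ≤ ∫ x in R₀..B, (deriv (ψ 0) x ^ 2 + deriv (fun τ => ψ τ x) 0 ^ 2) :=
    intervalIntegral.integral_mono_on hR₀B ((hh'.pow 2).intervalIntegrable _ _)
      (((hh'.pow 2).add (hg.pow 2)).intervalIntegrable _ _)
      fun x _ => by simp only [hh]; nlinarith [sq_nonneg (deriv (fun τ => ψ τ x) 0)]
  rw [hsplit]
  linarith

/-- **The two-sided far estimate for compactly supported far data (one mode).**  See the module
docstring. [folklore in method; new] -/
theorem stub_farHalfShare_compact (s ℓ : ℕ) (hs : s ≤ 2) (hsℓ : s ≤ ℓ) :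
    ∃ Rc : ℝ, 3 ≤ Rc ∧ ∀ R₀ B : ℝ, Rc ≤ R₀ → R₀ ≤ B → ∀ ψ : ℝ → ℝ → ℝ,
      IsRWSolution 1 s ℓ (tortoiseRadius one_pos 0) ψ → CauchyDataSupportedOn ψ (Ioo R₀ B) →
        ENNReal.ofReal (1 / 16) * totalEnergy (linePotential 1 s ℓ (tortoiseRadius one_pos 0)) ψ 0
          ≤ liminf (fun t => ∫⁻ x in Ioi |t|, ENNReal.ofReal
              (energyDensity (linePotential 1 s ℓ (tortoiseRadius one_pos 0)) ψ t x)) atTop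
            + liminf (fun t => ∫⁻ x in Ioi |t|, ENNReal.ofReal
              (energyDensity (linePotential 1 s ℓ (tortoiseRadius one_pos 0)) ψ t x)) atBot := by
  have hr := isTortoiseRadius_tortoiseRadius one_pos (0 : ℝ)
  have hVd : Differentiable ℝ (linePotential 1 s ℓ (tortoiseRadius one_pos 0)) :=
    RW.differentiable_linePotential hr s ℓ
  have hV0 : ∀ x, 0 ≤ linePotential 1 s ℓ (tortoiseRadius one_pos 0) x :=
    fun x => (RW.linePotential_pos hr hsℓ x).le
  rcases Nat.eq_zero_or_pos ℓ with hℓ0 | hℓ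
  · -- `ℓ = 0`, hence `s = 0`: the free model
    have hs0 : s = 0 := by omega
    subst hℓ0; subst hs0
    refine ⟨4096 * 54 + 108, by norm_num, ?_⟩
    intro R₀ B hR₀ hR₀B ψ hψ hsupp
    have hC := hψ.1
    have hh : ContDiff ℝ 2 (ψ 0) := hC.comp (contDiff_const.prodMk contDiff_id)
    have hg : ContDiff ℝ 1 (fun x => deriv (fun τ => ψ τ x) 0) := contDiff_one_tslice_deriv hC 0
    obtain ⟨φ, hφC, hφsol, hd0, hd1, hmodel⟩ :=
      free_coneModelWave hh hg (R₁ := R₀) (B := B) (by linarith) hR₀B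
    refine stub_farHalfShare_transfer (V₀ := fun _ => 0) hVd hV0 continuous_const (fun _ => le_rfl) (X := 1)
      (D := Real.sqrt 54) one_pos (by linarith) (Real.sqrt_nonneg _)
      (by rw [Real.sq_sqrt (by norm_num)]; linarith) hR₀B ?_ ?_ hψ hsupp hφC ?_
      (fun x => ⟨hd0 x, hd1 x⟩) (energy_le_two_model_zero hψ (by linarith) hR₀B hsupp) ?_
    · intro x hx
      have hx0 : 0 < x := by linarith
      rw [Real.sq_sqrt (by norm_num), zero_sub, neg_sq, sq]
      exact mul_le_mul_of_nonneg_right (far_bound_zero hx0) (hV0 x)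
    · intro x _
      show (1 - 1 / 2) * (0 : ℝ) ≤ _
      rw [mul_zero]; exact hV0 x
    · intro t x _
      rw [zero_mul, add_zero]
      exact hφsol t x
    · simpa only [zero_mul, add_zero] using hmodel
  · -- `ℓ ≥ 1`: the inverse-square model
    obtain ⟨ι, hι, hιeq, -, I, hI, hI'⟩ := exists_smooth_inv_extension
    set A : ℝ := 200 * ((ℓ : ℝ) + 1) ^ 2 with hA
    refine ⟨max (max 9 (4 * A ^ 2)) (max (2 * max 9 (4 * A ^ 2)) (4096 * A ^ 2)), ?_, ?_⟩
    · exact le_trans (by norm_num) ((le_max_left _ _).trans (le_max_left _ _))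
    intro R₀ B hR₀ hR₀B ψ hψ hsupp
    have hX : max 9 (4 * A ^ 2) ≤ R₀ := (le_max_left _ _).trans hR₀
    have h2X : 2 * max 9 (4 * A ^ 2) ≤ R₀ := ((le_max_left _ _).trans (le_max_right _ _)).trans hR₀
    have hbig : 4096 * A ^ 2 ≤ R₀ := ((le_max_right _ _).trans (le_max_right _ _)).trans hR₀
    have hC := hψ.1
    have hh : ContDiff ℝ 2 (ψ 0) := hC.comp (contDiff_const.prodMk contDiff_id)
    have hg : ContDiff ℝ 1 (fun x => deriv (fun τ => ψ τ x) 0) := contDiff_one_tslice_deriv hC 0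
    have hdat0 : ∀ x, x ∉ Ioo R₀ B → ψ 0 x = 0 ∧ deriv (fun τ => ψ τ x) 0 = 0 := hsupp
    obtain ⟨φ, hφC, hφsol, hd0, hd1, hmodel⟩ := inverseSquare_coneModelWave hι hιeq hI hI' hℓ hh hg
      (R₁ := R₀) (B := B) (by linarith [(le_max_left _ _).trans hX]) hR₀B
      (fun x hx => (hdat0 x fun h => by linarith [h.1]).1)
      (fun x hx => (hdat0 x fun h => by linarith [h.1]).2)
      (fun x hx => (hdat0 x fun h => by linarith [h.2]).1)
      (fun x hx => (hdat0 x fun h => by linarith [h.2]).2)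
    have hX0 : 0 < max 9 (4 * A ^ 2) := lt_of_lt_of_le (by norm_num) (le_max_left _ _)
    refine stub_farHalfShare_transfer (V₀ := fun x => (ℓ : ℝ) * (ℓ + 1) * ι x ^ 2) hVd hV0
      (continuous_const.mul (hι.continuous.pow 2)) (fun x => by positivity) hX0 h2X
      (D := A) (by positivity) hbig hR₀B ?_ ?_ hψ hsupp hφC hφsol (fun x => ⟨hd0 x, hd1 x⟩)
      (energy_le_two_model_pos hs hsℓ hℓ hι.continuous hιeq hψ hX hR₀B hsupp) hmodel
    · intro x hx
      have hx0 : 0 < x := hX0.trans_le hx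
      have hι2 : ι x ^ 2 = (x ^ 2)⁻¹ := by rw [hιeq x (by linarith [(le_max_left _ _).trans hx]), inv_pow]
      rw [hι2]
      exact (far_bounds_pos hs hℓ hx).2.2
    · intro x hx
      have hι2 : ι x ^ 2 = (x ^ 2)⁻¹ := by rw [hιeq x (by linarith [(le_max_left _ _).trans hx]), inv_pow]
      rw [hι2]
      exact (far_bounds_pos hs hℓ hx).1

end FarHalfShareModel

end Summit.FinalStateConjecture.FinalStateConjecture.Theorems.WindowedShellChannelsSketch

end
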